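import Mathlib
import HarnessLib
import Literature.Geometry.Lorentzian.NearKerrLeaf
import Literature.Geometry.Lorentzian.NearKerrCollarCore
import Summits.FinalStateConjecture.FinalStateConjecture.Theorems.BartnikGapSettlingBondiBartnikRigidityTrivialRegime

/-!
# Crux-triage r1 k1 — scratch checks for crux `BondiBartnikRigidity` (stmt-FinalStateConjecture-10807)

Check T1: the first lemma `PerturbativeCollarCoercivity` (C2) of card
`brill-deser-outside-the-ergosphere`, typed verbatim from the card (`∃ k' Λ₀, 0 < Λ₀ ∧ ∀ Λ ≤ Λ₀, …`
with `Λ₀` chosen AFTER `ε`), is TRIVIALLY TRUE: take `k' := k`, `Λ₀ := ε`; then every admissible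
`Λ ≤ Λ₀ = ε` is in the trivial regime of the landed theorem `stub_trivialRegime` (p103152) and
`S' := S` works. So C2 as typed certifies nothing; the content the card intends needs `Λ₀` to be
chosen BEFORE `ε` (see `PerturbativeCollarCoercivitySharp` below, which is NOT closed here).
-/

set_option linter.dupNamespace false

namespace Summit.FinalStateConjecture.FinalStateConjecture.Cruxes.BondiBartnikRigidity.Triage

open Set Literature.Geometry.Lorentzian
open scoped Manifold ContDiff Topology ENNReal

/-- C2 of card `brill-deser-outside-the-ergosphere`, verbatim quantifier shape
(`∀ χ m₀ k ε, χ<1 → 0<m₀ → 0<ε → ∃ k' Λ₀, 0<Λ₀ ∧ ∀ Λ ≤ Λ₀, ∃ δ γ, 0<δ ∧ 0<γ ∧ ∀ X …`). -/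
def PerturbativeCollarCoercivity : Prop :=
  ∀ (χ m₀ : ℝ) (k : ℕ) (ε : ℝ≥0∞), χ < 1 → 0 < m₀ → 0 < ε →
    ∃ (k' : ℕ) (Λ₀ : ℝ≥0∞), 0 < Λ₀ ∧ ∀ Λ : ℝ≥0∞, Λ ≤ Λ₀ →
      ∃ (δ : ℝ≥0∞) (γ : ℝ), 0 < δ ∧ 0 < γ ∧
        ∀ (X : Type) [TopologicalSpace X] [ChartedSpace E3 X] [IsManifold (𝓡 3) ∞ X]
          [T2Space X] [SecondCountableTopology X] [ConnectedSpace X],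
          ∀ D ∈ admissibleVacuumData X, ∀ (𝒟 : VacuumCauchyDevelopment D) (N : ℕ)
            (M a : Fin N → ℝ) (S : Set 𝒟.carrier) (p : 𝒟.carrier)
            (mo : Fin N → lorentzGroup × E4) (B : Fin N → ModelBackground)
            (Φ : ∀ i, (B i).domain → 𝒟.carrier),
            𝒟.IsMaximal → N ≤ 1 → (∀ i, m₀ ≤ M i ∧ M i ≤ m₀⁻¹ ∧ |a i| ≤ χ * M i) →
            𝒟.toCauchyDevelopment.IsNearKerrLeaf k' Λ N M a S → p ∈ S →
            𝒟.NearKerrCollarCore k' δ γ N M a S p mo B Φ →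
            ∃ S' : Set 𝒟.carrier, 𝒟.toCauchyDevelopment.IsNearKerrLeaf k ε N M a S' ∧
              S' ⊆ 𝒟.metric.causalFuture 𝒟.timeOrientation S

/-- **T1.** C2 as typed is trivially true (Λ₀ := ε, k' := k, S' := S). -/
theorem perturbativeCollarCoercivity_trivial : PerturbativeCollarCoercivity := by
  intro χ m₀ k ε _ _ hε
  refine ⟨k, ε, hε, fun Λ hΛ => ⟨1, 1, one_pos, one_pos, ?_⟩⟩
  intro X _ _ _ _ _ _ D _ 𝒟 N M a S p mo B Φ _ _ _ hleaf _ _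
  exact Theorems.stub_trivialRegime k k ε Λ le_rfl hΛ X D 𝒟 N M a S hleaf

/-- The sharpening the card intends: `Λ₀` chosen BEFORE `ε` (content for every `ε < Λ₀`).
Not closed here (open). -/
def PerturbativeCollarCoercivitySharp : Prop :=
  ∀ (χ m₀ : ℝ) (k : ℕ), χ < 1 → 0 < m₀ →
    ∃ Λ₀ : ℝ≥0∞, 0 < Λ₀ ∧ ∀ ε : ℝ≥0∞, 0 < ε →
      ∃ k' : ℕ, ∀ Λ : ℝ≥0∞, Λ ≤ Λ₀ →
      ∃ (δ : ℝ≥0∞) (γ : ℝ), 0 < δ ∧ 0 < γ ∧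
        ∀ (X : Type) [TopologicalSpace X] [ChartedSpace E3 X] [IsManifold (𝓡 3) ∞ X]
          [T2Space X] [SecondCountableTopology X] [ConnectedSpace X],
          ∀ D ∈ admissibleVacuumData X, ∀ (𝒟 : VacuumCauchyDevelopment D) (N : ℕ)
            (M a : Fin N → ℝ) (S : Set 𝒟.carrier) (p : 𝒟.carrier)
            (mo : Fin N → lorentzGroup × E4) (B : Fin N → ModelBackground)
            (Φ : ∀ i, (B i).domain → 𝒟.carrier),
            𝒟.IsMaximal → N ≤ 1 → (∀ i, m₀ ≤ M i ∧ M i ≤ m₀⁻¹ ∧ |a i| ≤ χ * M i) →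
            𝒟.toCauchyDevelopment.IsNearKerrLeaf k' Λ N M a S → p ∈ S →
            𝒟.NearKerrCollarCore k' δ γ N M a S p mo B Φ →
            ∃ S' : Set 𝒟.carrier, 𝒟.toCauchyDevelopment.IsNearKerrLeaf k ε N M a S' ∧
              S' ⊆ 𝒟.metric.causalFuture 𝒟.timeOrientation S

theorem probe_sharp : PerturbativeCollarCoercivitySharp := by
  sorry

end Summit.FinalStateConjecture.FinalStateConjecture.Cruxes.BondiBartnikRigidity.Triage
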